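import Literature.NumberTheory.IwasawaTheory.ClassicalMuVanishesQuadraticAscentShift
import Literature.NumberTheory.IwasawaTheory.ClassicalMuVanishesTwoPowerGaloisRat
import Literature.NumberTheory.IwasawaTheory.ClassNumberPExpZeroCyclotomicFour
import HarnessLib

/-!
# `μ₂ = 0` for EVERY finite Galois `2`-power extension of `ℚ` and every cyclotomic `ℤ₂`-extension — Iwasawa 1973 Thm. 3 + §4 at `l = 2`
# with NO linear-disjointness proviso (`ℚ(ζ_{2^s})`, `ℚ(√±2)`, `ℚ_n = ℚ(ζ_{2^{n+2}})⁺`, `2`-power fields through `√2` included; proved, no named fact)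

`Proofs`-style file (theorems only, no `sorry`) in topic `NumberTheory/IwasawaTheory` (namespace `Literature.NumberTheory.IwasawaTheory`),
written by the prover seat `bsd-line-att-p3` g36 (cell `bsd-f1-sign2`, route `AlignedTransportAtTwo`, `--supports` stmt-BirchSwinnertonDyer-22298;
closes nothing; nothing about elliptic curves or BSD is asserted).  Sequel of `ClassicalMuVanishesQuadraticAscentShift` (the per-layer bound with
no surjectivity) and of g35's `ClassicalMuVanishesTwoPowerAscent` / `ClassicalMuVanishesTwoPowerGaloisRat`, whose «`√2 ∉ K'`, `√−2 ∉ K'`»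
binders (the tree's restricted currency `K' ∩ ℚ_∞ = ℚ`) are REMOVED here: Iwasawa's theorem verbatim.

Iwasawa 1973, Thm. 3: «Let `k` be totally imaginary if `l = 2`, `K/k` a finite Galois `l`-extension …  `μ(k) = 0 ⟹ μ(K) = 0`» (cyclotomic
`ℤ_l`-extensions); §4: «for `l = 2` … let `k' = k(√−1)` … `μ₂(ℚ(√−1)) = 0` … Theorem 3 … `μ₂(k') = 0` … hence `μ₂(k) = 0`».

* §1 ★★★ **`classicalMu_of_finrank_eq_two_of_subsingleton_realEmbedding`** — the quadratic step `K ⊆ K'` (`[K' : K] = 2`, `K'` totally complex,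
  `K` with at most one real embedding), intrinsic and proviso-free: «`ClassicalMuVanishes` for every cyclotomic `ℤ₂`-extension of `K`» ⟹ «the same
  for `K'`» (shifted towers of `K`, `K'` read off the fields `j(K)·ℚ_m ⊆ j'(K')·ℚ_m`, all `m`); ★★ `classicalMu_of_finrank_eq_two_of_isTotallyComplex`
  (`K` totally complex: Thm. 3, one step, verbatim).
* §2 ★★ **`classicalMu_of_isGalois_of_finrank_eq_two_pow_of_isTotallyComplex'`** — `K'/K` Galois of degree `2^m`, `K` totally complex: the same
  ascent (normal series of the `2`-group; a subgroup of index `2` is normal) — Thm. 3 at `l = 2` in full, NO «`√2 ∉ K'`».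
* §3 ★★★ **`classicalMuVanishes_of_isGalois_rat_of_finrank_eq_two_pow'`** — `K'/ℚ` finite Galois, `[K' : ℚ] = 2^m` ⟹ `ClassicalMuVanishes κ'`
  for EVERY cyclotomic `ℤ₂`-extension `κ'` of `K'`; NO proviso (§4 route: `M = j(K')·ℚ(i)` is Galois of `2`-power degree over the totally complex
  `ℚ(i)`, `μ₂(ℚ(i)) = 0` by genus theory, ascend, descend along `K' → M` with the hI-free finite descent).  Non-abelian `2`-groups (`D₄`, `Q₈`,
  …) included; no `L`-function anywhere.
* §4 corollaries, all formerly EXCLUDED by the proviso: ★★ `classicalMuVanishes_of_algebra_isGalois_rat_of_finrank_eq_two_pow` (every number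
  field EMBEDDING into a Galois `2`-power extension of `ℚ` — `C₄`/`V₄`/`D₄` quartics, `ℚ(2^{1/2^n})`, …), `classicalMuVanishes_of_isCyclotomicExtension_two_pow` (`ℚ(ζ_{2^{k+2}})`; also
  directly by Weber + Iwasawa 1956, stated for comparison), `classicalMuVanishes_layer_rat_two` (the layers `ℚ_n` of `ℚ_∞` themselves),
  `classicalMu_of_isGalois_of_finrank_eq_two_pow_over_imaginaryQuadratic'` (every Galois `2`-power extension of an imaginary quadratic field —
  `2`-class field towers of `ℚ(√−1)`, `ℚ(√−2)` included).

HONEST SCOPE.  In print since 1973 (and, for abelian `K'`, Ferrero–Washington 1979); the point is a fact-free kernel proof with the printed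
hypotheses and nothing more.  Totally real towers over a non-totally-complex base other than `ℚ` (Thm. 2 with real places) are not treated here
beyond what §3 gives (every totally real Galois `2`-power extension of `ℚ`).

References: [Iwasawa1973MuInvariants] Thm. 2, Thm. 3, §3 (remark after Thm. 2), §4 (case `l = 2`); [Washington1997] §13.1, §13.3 Prop. 13.23,
Prop. 4.11, Cor. 10.5; [FerreroWashington1979]; [Lang1990] Ch. 13 §4.
-/

set_option autoImplicit false

noncomputable section

open scoped NumberField Classical IntermediateField
open NumberField Field IntermediateField IsDedekindDomain Module Polynomial

namespace Literature.NumberTheory.IwasawaTheory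

open Literature.NumberTheory.EllipticCurves Literature.NumberTheory.EllipticCurves.ZpExtension
  Literature.NumberTheory.GaloisRepresentations Literature.NumberTheory.NumberFields
  Literature.NumberTheory.QuadraticFields

/-! ## §1 The quadratic step, intrinsic and proviso-free -/

set_option maxHeartbeats 400000 in
/-- ★★★ **Iwasawa's `μ₂ = 0` ascends every quadratic extension `K ⊆ K'` with `K'` totally complex and `K` having at most one real embedding —
NO hypothesis on `K ∩ ℚ_∞` or `K' ∩ ℚ_∞`.**  If `ClassicalMuVanishes κK` for every cyclotomic `ℤ₂`-extension `κK` of `K`, then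
`ClassicalMuVanishes κ'` for every cyclotomic `ℤ₂`-extension `κ'` of `K'`.  Proof: shifted base changes `κ₁` of `K` (`2^a κ₁ = κ ∘ res`, layers
`≅ A_{n+a}`) and `κ₁'` of `K'` (layers `≅ B_{n+a'}`) of the cyclotomic `κ` of `ℚ` are cyclotomic (`isCyclotomic_of_shift`); `μ(κ₁) = 0` bounds
`rank₂ Cl(A_m)` for all `m` (finitely many `m < a` aside); the prequel's §3 bounds `rank₂ Cl(B_m)` for all `m`; bounded ranks give `μ(κ₁') = 0`
(`classicalMuVanishes_of_forall_classGroupPRank_le`), and every cyclotomic `κ'` shares `κ₁'`'s layers.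
[cite: Iwasawa1973MuInvariants, Thm. 3 and §3–§4] [cite: Washington1997, §13.1 and §13.3 Prop. 13.23] -/
theorem classicalMu_of_finrank_eq_two_of_subsingleton_realEmbedding (K K' : Type) [Field K] [NumberField K] [Field K']
    [NumberField K'] [Algebra K K'] [IsTotallyComplex K'] [Subsingleton (K →+* ℝ)] (hdeg : Module.finrank K K' = 2)
    (hμ : ∀ κK : ZpExtension K 2, κK.IsCyclotomic → ClassicalMuVanishes κK) :
    ∀ κ' : ZpExtension K' 2, κ'.IsCyclotomic → ClassicalMuVanishes κ' := by
  intro κ' hκ'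
  haveI : Fact (Nat.Prime 2) := ⟨Nat.prime_two⟩
  haveI : IsScalarTower ℚ K K' := IsScalarTower.of_algebraMap_eq' (Subsingleton.elim _ _)
  haveI : FiniteDimensional K K' := Module.Finite.of_restrictScalars_finite ℚ K K'
  obtain ⟨x, m₀, hm, hx, hgen⟩ := exists_integral_sqrt_generator_of_finrank_eq_two K K' hdeg
  obtain ⟨κ, hκ⟩ := exists_cyclotomicZpExtension_holds ℚ 2
  set j' : K' →ₐ[ℚ] AlgebraicClosure ℚ := absEmbedding ℚ K' with hj'
  set j : K →ₐ[ℚ] AlgebraicClosure ℚ := j'.comp (IsScalarTower.toAlgHom ℚ K K') with hj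
  -- the shifted towers of `K` and `K'`
  obtain ⟨a, κ₁, hs⟩ := exists_zpExtension_shift κ K
  obtain ⟨a', κ₁', hs'⟩ := exists_zpExtension_shift κ K'
  have hκ₁ : κ₁.IsCyclotomic := isCyclotomic_of_shift κ K κ₁ hs hκ
  have hκ₁' : κ₁'.IsCyclotomic := isCyclotomic_of_shift κ K' κ₁' hs' hκ
  refine (classicalMuVanishes_iff_of_isCyclotomic κ₁' κ' hκ₁' hκ').mp ?_
  -- bounded `2`-ranks of the `A_m`, all `m`
  set rA : ℕ → ℕ := fun n ↦ padicValNat 2 (Nat.card (ClassGroup (𝓞 ↥(j.fieldRange ⊔ κ.layer n)) ⧸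
    (powMonoidHom 2 : ClassGroup (𝓞 ↥(j.fieldRange ⊔ κ.layer n)) →* _).range)) with hrA
  set rB : ℕ → ℕ := fun n ↦ padicValNat 2 (Nat.card (ClassGroup (𝓞 ↥(j'.fieldRange ⊔ κ.layer n)) ⧸
    (powMonoidHom 2 : ClassGroup (𝓞 ↥(j'.fieldRange ⊔ κ.layer n)) →* _).range)) with hrB
  obtain ⟨R, hR⟩ := exists_forall_classGroupPRank_le_of_classicalMuVanishes κ₁ (hμ κ₁ hκ₁)
  have hrAshift : ∀ n, rA (n + a) ≤ R := fun n ↦ by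
    have h := hR n
    rwa [classGroupPRank_eq_of_layerSubgroup_eq κ K κ₁ (layerSubgroup_eq_comap_of_shift κ K κ₁ hs n) j] at h
  set R' : ℕ := R + ∑ i ∈ Finset.range a, rA i with hR'
  have hrAle : ∀ n, rA n ≤ R' := fun n ↦ by
    rcases Nat.lt_or_ge n a with hlt | hge
    · have h1 : rA n ≤ ∑ i ∈ Finset.range a, rA i :=
        Finset.single_le_sum (f := rA) (fun i _ ↦ Nat.zero_le _) (Finset.mem_range.mpr hlt)
      omega
    · obtain ⟨k, rfl⟩ : ∃ k, n = k + a := ⟨n - a, by omega⟩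
      exact (hrAshift k).trans (Nat.le_add_right _ _)
  -- the per-layer bound, every `m`
  set T : ℕ := ∑ ℓ ∈ ((Ideal.absNorm (Ideal.span {(4 * m₀ : 𝓞 K)}) : ℤ)).natAbs.primeFactors, Module.finrank ℚ K * ℓ ^ 2 with hT
  have hlayer : ∀ n, rB n ≤ 2 * (2 * R' + T) := fun n ↦ by
    have h := padicValNat_card_quotient_fieldRange_sup_layer_le κ hκ K K' hm hx hgen j' n
    have h2 : 2 * (2 * rA n + T) ≤ 2 * (2 * R' + T) := by
      have := hrAle n
      nlinarith
    exact h.trans h2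
  -- conclusion for the shifted tower of `K'`
  refine classicalMuVanishes_of_forall_classGroupPRank_le κ₁' (B := 2 * (2 * R' + T)) fun n ↦ ?_
  rw [classGroupPRank_eq_of_layerSubgroup_eq κ K' κ₁' (layerSubgroup_eq_comap_of_shift κ K' κ₁' hs' n) j']
  exact hlayer (n + a')

/-- A totally complex number field has no ring morphism to `ℝ`. [folklore] -/
private theorem false_of_ringHom_real₃ {K : Type} [Field K] [NumberField K] [IsTotallyComplex K] (ρ : K →+* ℝ) : False := by
  have h : ComplexEmbedding.IsReal (Complex.ofRealHom.comp ρ) := by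
    rw [ComplexEmbedding.isReal_iff]
    ext x
    simp [ComplexEmbedding.conjugate_coe_eq]
  exact IsTotallyComplex.complexEmbedding_not_isReal _ h

/-- ★★ **Iwasawa 1973 Thm. 3 at `ℓ = 2`, one step, verbatim: `μ₂ = 0` ascends every quadratic extension `K ⊆ K'` of a TOTALLY COMPLEX number
field `K`** — for the cyclotomic `ℤ₂`-extensions, with no linear-disjointness proviso, no generator and no signature hypothesis (`K'` is then
totally complex and `K` has no real embedding). [cite: Iwasawa1973MuInvariants, Thm. 3] [cite: Washington1997, §13.3 Prop. 13.23] -/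
theorem classicalMu_of_finrank_eq_two_of_isTotallyComplex (K K' : Type) [Field K] [NumberField K] [Field K'] [NumberField K']
    [Algebra K K'] [IsTotallyComplex K] (hdeg : Module.finrank K K' = 2)
    (hμ : ∀ κK : ZpExtension K 2, κK.IsCyclotomic → ClassicalMuVanishes κK) :
    ∀ κ' : ZpExtension K' 2, κ'.IsCyclotomic → ClassicalMuVanishes κ' := by
  haveI : IsTotallyComplex K' := isTotallyComplex_of_algebra (F := K) K'
  haveI : Subsingleton (K →+* ℝ) := ⟨fun φ _ ↦ (false_of_ringHom_real₃ φ).elim⟩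
  exact classicalMu_of_finrank_eq_two_of_subsingleton_realEmbedding K K' hdeg hμ


/-! ## §2 The `2`-power Galois ascent over a totally complex base — Iwasawa 1973 Thm. 3 at `l = 2`, no proviso -/

/-- ★★ **Iwasawa 1973 Thm. 3 at `l = 2`: `μ₂ = 0` ascends every finite GALOIS `2`-POWER extension `K'` of a TOTALLY COMPLEX number field `K`**, for
the cyclotomic `ℤ₂`-extensions, with NO linear-disjointness proviso: induction along a normal series of the `2`-group `Gal(K'/K)` (a Sylow
subgroup `H` of order `2^m` has index `2`, hence is normal; `K ⊆ K'^H` is the quadratic step §1 over the totally complex `K`, and `K'/K'^H` is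
Galois of degree `2^m` over the totally complex `K'^H`). [cite: Iwasawa1973MuInvariants, Thm. 3] [cite: Washington1997, §13.3 Prop. 13.23] -/
theorem classicalMu_of_isGalois_of_finrank_eq_two_pow_of_isTotallyComplex' :
    ∀ (m : ℕ) (K K' : Type) [Field K] [NumberField K] [Field K'] [NumberField K'] [Algebra K K']
      [IsGalois K K'] [IsTotallyComplex K], Module.finrank K K' = 2 ^ m →
      (∀ κK : ZpExtension K 2, κK.IsCyclotomic → ClassicalMuVanishes κK) →
      ∀ κ' : ZpExtension K' 2, κ'.IsCyclotomic → ClassicalMuVanishes κ' := by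
  haveI : Fact (Nat.Prime 2) := ⟨Nat.prime_two⟩
  intro m
  induction m with
  | zero =>
    intro K K' _ _ _ _ _ _ _ hdeg hμ κ' hκ'
    haveI : IsScalarTower ℚ K K' := IsScalarTower.of_algebraMap_eq' (Subsingleton.elim _ _)
    haveI : FiniteDimensional K K' := Module.Finite.of_restrictScalars_finite ℚ K K'
    have hsurj : Function.Surjective (algebraMap K K') := fun x => by
      have hx : x ∈ (⊥ : Subalgebra K K') := by
        rw [Subalgebra.bot_eq_top_of_finrank_eq_one (by rw [hdeg, pow_zero])]; exact Algebra.mem_top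
      exact Algebra.mem_bot.mp hx
    -- `K' ≅ K`: descend along the inverse isomorphism `K' → K`
    let e : K ≃+* K' := RingEquiv.ofBijective (algebraMap K K') ⟨(algebraMap K K').injective, hsurj⟩
    letI : Algebra K' K := e.symm.toRingHom.toAlgebra
    exact classicalMuVanishes_of_isCyclotomic_of_finite_noGrowth κ' hκ' K hμ
  | succ m ih =>
    intro K K' _ _ _ _ _ _ _ hdeg hμ κ' hκ'
    haveI : IsScalarTower ℚ K K' := IsScalarTower.of_algebraMap_eq' (Subsingleton.elim _ _)
    haveI : FiniteDimensional K K' := Module.Finite.of_restrictScalars_finite ℚ K K'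
    -- a normal subgroup of index `2`
    have hcardG : Nat.card (K' ≃ₐ[K] K') = 2 ^ (m + 1) := by rw [IsGalois.card_aut_eq_finrank, hdeg]
    obtain ⟨H, hH⟩ := Sylow.exists_subgroup_card_pow_prime 2 (n := m) (G := K' ≃ₐ[K] K')
      (by rw [hcardG]; exact pow_dvd_pow 2 (Nat.le_succ m))
    have hindex : H.index = 2 := by
      have h1 := H.index_mul_card
      rw [hH, hcardG, pow_succ, mul_comm (2 ^ m) 2] at h1
      exact Nat.eq_of_mul_eq_mul_right (pow_pos two_pos m) h1
    haveI : H.Normal := Subgroup.normal_of_index_eq_two hindex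
    -- the intermediate field `M = K'^H`, totally complex
    set M : IntermediateField K K' := IntermediateField.fixedField H with hM
    haveI : NumberField ↥M := NumberField.of_module_finite K ↥M
    haveI : IsGalois ↥M K' := IsGalois.tower_top_of_isGalois K ↥M K'
    haveI : IsTotallyComplex ↥M := isTotallyComplex_of_algebra (F := K) ↥M
    have hMK' : Module.finrank ↥M K' = 2 ^ m := by rw [hM, IntermediateField.finrank_fixedField_eq_card, hH]
    have hKM : Module.finrank K ↥M = 2 := by
      have h1 := Module.finrank_mul_finrank K ↥M K'
      rw [hMK', hdeg, pow_succ, mul_comm (2 ^ m) 2] at h1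
      exact Nat.eq_of_mul_eq_mul_right (pow_pos two_pos m) h1
    -- the quadratic step `K ⊆ M`, then the induction hypothesis for `M ⊆ K'`
    have hμM : ∀ κM : ZpExtension ↥M 2, κM.IsCyclotomic → ClassicalMuVanishes κM :=
      classicalMu_of_finrank_eq_two_of_isTotallyComplex K ↥M hKM hμ
    exact ih ↥M K' hMK' hμM κ' hκ'

/-! ## §3 Iwasawa 1973 §4, `l = 2`: every finite Galois `2`-power extension of `ℚ` -/

set_option maxHeartbeats 400000 in
/-- ★★★ **`μ₂ = 0` for EVERY finite Galois `2`-power extension of `ℚ` and every cyclotomic `ℤ₂`-extension — Iwasawa 1973 §4 (`l = 2`) verbatim,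
no proviso.**  `K'/ℚ` Galois with `[K' : ℚ] = 2^m`, `κ'` any cyclotomic `ℤ₂`-extension of `K'`: `ClassicalMuVanishes κ'` (growth form
`e_n = λ n + ν`, `n ≫ 0`).  Route: `M = j(K')·ℚ(i) ⊆ ℚ̄` is Galois of `2`-power degree over the totally complex `ℚ(i)` (`μ₂(ℚ(i)) = 0`, genus
theory), §2 gives `μ₂ = 0` on `M`, and `μ = 0` descends along `K' → M` (hI-free finite descent).  `ℚ(ζ_{2^s})`, `ℚ(√2)`, `ℚ(√−2)`,
`ℚ(ζ_{2^{n+2}})⁺`, `ℚ(ζ₁₆)⁺(i)`, dihedral/quaternion fields through `√±2` — all included; fact-free; no `L`-functions.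
[cite: Iwasawa1973MuInvariants, Thm. 3 and §4 (case l = 2)] [cite: Washington1997, §13.3 Prop. 13.23 and Prop. 4.11] -/
theorem classicalMuVanishes_of_isGalois_rat_of_finrank_eq_two_pow' (K' : Type) [Field K'] [NumberField K'] [IsGalois ℚ K']
    (m : ℕ) (hdeg : Module.finrank ℚ K' = 2 ^ m) (κ' : ZpExtension K' 2) (hκ' : κ'.IsCyclotomic) : ClassicalMuVanishes κ' := by
  haveI : Fact (Nat.Prime 2) := ⟨Nat.prime_two⟩
  -- the copy `E = j(K') ⊆ ℚ̄`, a root `i` of `X² + 1`, `ℚ(i)` and the compositum `M = E ⊔ ℚ(i)`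
  set e : K' →ₐ[ℚ] AlgebraicClosure ℚ := absEmbedding ℚ K' with he
  set E : IntermediateField ℚ (AlgebraicClosure ℚ) := e.fieldRange with hE
  obtain ⟨i, hi⟩ : ∃ i : AlgebraicClosure ℚ, i ^ 2 = -1 := IsAlgClosed.exists_pow_nat_eq (-1) two_pos
  set Qi : IntermediateField ℚ (AlgebraicClosure ℚ) := IntermediateField.adjoin ℚ ({i} : Set (AlgebraicClosure ℚ)) with hQi
  set M : IntermediateField ℚ (AlgebraicClosure ℚ) := E ⊔ Qi with hM
  have hint : IsIntegral ℚ i := by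
    refine ⟨X ^ 2 + 1, monic_X_pow_add_C _ two_ne_zero, ?_⟩
    simp [hi]
  haveI : FiniteDimensional ℚ ↥E := (AlgEquiv.ofInjectiveField e).toLinearEquiv.finiteDimensional
  haveI : FiniteDimensional ℚ ↥Qi := IntermediateField.adjoin.finiteDimensional hint
  haveI : FiniteDimensional ℚ ↥M := IntermediateField.finiteDimensional_sup E Qi
  haveI : NumberField ↥E := NumberField.of_module_finite ℚ _
  haveI : NumberField ↥Qi := NumberField.of_module_finite ℚ _
  haveI : NumberField ↥M := NumberField.of_module_finite ℚ _
  -- Galois properties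
  haveI hEgal : IsGalois ℚ ↥E := IsGalois.of_algEquiv (AlgEquiv.ofInjectiveField e)
  have hiQ : i ∉ Set.range (algebraMap ℚ (AlgebraicClosure ℚ)) := by
    rintro ⟨q, hq⟩
    have h1 : (algebraMap ℚ (AlgebraicClosure ℚ)) (q ^ 2) = algebraMap ℚ (AlgebraicClosure ℚ) (-1) := by
      rw [map_pow, hq, hi, map_neg, map_one]
    have h2' : q ^ 2 = -1 := (algebraMap ℚ (AlgebraicClosure ℚ)).injective h1
    nlinarith [sq_nonneg q]
  have hQi2 : Module.finrank ℚ ↥Qi = 2 :=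
    finrank_adjoin_simple_eq_two_of_sq_eq (a := (-1 : ℚ)) (by rw [hi, map_neg, map_one]) hiQ
  haveI : Algebra.IsQuadraticExtension ℚ ↥Qi := ⟨hQi2⟩
  haveI hQigal : IsGalois ℚ ↥Qi := inferInstance
  -- (the compositum of Galois subfields is Galois; instances passed explicitly across the `ℚ`-algebra diamond on subfields of `ℚ̄`)
  haveI : IsGalois ℚ ↥M :=
    @FiniteGaloisIntermediateField.instIsGaloisSubtypeMemIntermediateFieldMax ℚ (AlgebraicClosure ℚ) _ _ _ E Qi hEgal hQigal
  have hQiM : Qi ≤ M := le_sup_right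
  have hEM : E ≤ M := le_sup_left
  letI : Algebra ↥Qi ↥M := (IntermediateField.inclusion hQiM).toRingHom.toAlgebra
  haveI : IsScalarTower ℚ ↥Qi ↥M := IsScalarTower.of_algebraMap_eq fun _ ↦ rfl
  haveI : IsGalois ↥Qi ↥M := IsGalois.tower_top_of_isGalois ℚ ↥Qi ↥M
  haveI : IsTotallyComplex ↥Qi :=
    ⟨FineSelmerUpstairs.isComplex_of_mem_sq_eq_neg_one i hi Qi (IntermediateField.mem_adjoin_simple_self ℚ i)⟩
  -- degrees: `[M : ℚ(i)]` is a power of `2`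
  letI : Algebra ↥E ↥M := (IntermediateField.inclusion hEM).toRingHom.toAlgebra
  haveI : IsScalarTower ℚ ↥E ↥M := IsScalarTower.of_algebraMap_eq fun _ ↦ rfl
  haveI : Module.Finite ↥E ↥M := Module.Finite.of_restrictScalars_finite ℚ ↥E ↥M
  haveI : Module.Finite ↥Qi ↥M := Module.Finite.of_restrictScalars_finite ℚ ↥Qi ↥M
  have hEdeg : Module.finrank ℚ ↥E = 2 ^ m := by
    rw [← hdeg]; exact (AlgEquiv.ofInjectiveField e).toLinearEquiv.finrank_eq.symm
  have htowerE := Module.finrank_mul_finrank ℚ ↥E ↥M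
  have htowerQ := Module.finrank_mul_finrank ℚ ↥Qi ↥M
  have hsup : Module.finrank ℚ ↥M ≤ Module.finrank ℚ ↥E * Module.finrank ℚ ↥Qi := IntermediateField.finrank_sup_le E Qi
  have ht1 : 1 ≤ Module.finrank ↥E ↥M := Module.finrank_pos
  have ht2 : Module.finrank ↥E ↥M ≤ 2 := by
    rw [hEdeg, hQi2] at hsup
    rw [hEdeg] at htowerE
    exact Nat.le_of_mul_le_mul_left (by rw [htowerE]; exact hsup) (pow_pos two_pos m)
  have key : 2 * Module.finrank ↥Qi ↥M = 2 ^ m * Module.finrank ↥E ↥M := by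
    have k := htowerQ.trans htowerE.symm
    rw [hQi2, hEdeg] at k
    exact k
  obtain ⟨a, ha⟩ : ∃ a : ℕ, Module.finrank ↥Qi ↥M = 2 ^ a := by
    interval_cases hEM' : Module.finrank ↥E ↥M
    · cases m with
      | zero => omega
      | succ m' => exact ⟨m', by rw [pow_succ] at key; omega⟩
    · exact ⟨m, by omega⟩
  -- base `μ₂(ℚ(i)) = 0`, the `2`-power ascent (no proviso), and descent to `K'`
  have hμQi : ∀ κP : ZpExtension ↥Qi 2, κP.IsCyclotomic → ClassicalMuVanishes κP :=
    fun κP hκP ↦ classicalMuVanishes_of_finrank_eq_two ↥Qi hQi2 κP hκP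
  have hμM : ∀ κM : ZpExtension ↥M 2, κM.IsCyclotomic → ClassicalMuVanishes κM :=
    classicalMu_of_isGalois_of_finrank_eq_two_pow_of_isTotallyComplex' a ↥Qi ↥M ha hμQi
  let f : K' →+* ↥M :=
    { toFun := fun x ↦ ⟨e x, hEM (e.mem_fieldRange.mpr ⟨x, rfl⟩)⟩
      map_one' := Subtype.ext (by simp)
      map_mul' := fun x y ↦ Subtype.ext (by simp)
      map_zero' := Subtype.ext (by simp)
      map_add' := fun x y ↦ Subtype.ext (by simp) }
  letI : Algebra K' ↥M := f.toAlgebra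
  exact classicalMuVanishes_of_isCyclotomic_of_finite_noGrowth κ' hκ' ↥M hμM

/-! ## §4 Formerly excluded fields -/

/-- ★★ **`μ₂ = 0` for every number field that EMBEDS into a finite Galois `2`-power extension of `ℚ`** (equivalently: whose Galois closure over `ℚ`
has `2`-power degree) and every cyclotomic `ℤ₂`-extension of it — e.g. every quartic field with Galois group `C₄`, `V₄` or `D₄` (`ℚ(2^{1/4}) ⊆
ℚ(2^{1/4}, i)`), `ℚ(2^{1/2^n})`, every subfield of `ℚ(ζ_{2^s})`, NOT assumed Galois: §3 on the big field and the hI-free finite descent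
(Iwasawa 1973 §3: `μ` does not increase under finite descent). [cite: Iwasawa1973MuInvariants, §3 (remark after Thm. 2) and §4]
[cite: Washington1997, Prop. 4.11 and §13.3 Prop. 13.23] -/
theorem classicalMuVanishes_of_algebra_isGalois_rat_of_finrank_eq_two_pow (K' L : Type) [Field K'] [NumberField K'] [Field L]
    [NumberField L] [Algebra K' L] [IsGalois ℚ L] (m : ℕ) (hdeg : Module.finrank ℚ L = 2 ^ m)
    (κ' : ZpExtension K' 2) (hκ' : κ'.IsCyclotomic) : ClassicalMuVanishes κ' :=
  classicalMuVanishes_of_isCyclotomic_of_finite_noGrowth κ' hκ' L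
    (fun κL hκL ↦ classicalMuVanishes_of_isGalois_rat_of_finrank_eq_two_pow' L m hdeg κL hκL)


/-- ★★ **`μ₂ = 0` for every `2`-power cyclotomic field `ℚ(ζ_{2^{k+2}})` and every cyclotomic `ℤ₂`-extension of it** (abelian of degree `2^{k+1}`
over `ℚ`; contains `√2` for `k ≥ 1` and `√−2`-or-`√−1` always — the fields the restricted currency could not reach).  Here as an instance of §3;
the sharper `e_n = 0` (Weber + Iwasawa 1956) is `classNumberPExp_eq_zero_of_isCyclotomicExtension_prime_pow` with
`odd_classNumber_of_isCyclotomicExtension_two_pow`. [cite: Iwasawa1973MuInvariants, §4] [cite: Washington1997, Cor. 10.5 and Prop. 13.22] -/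
theorem classicalMuVanishes_of_isCyclotomicExtension_two_pow (N : Type) [Field N] [NumberField N] (k : ℕ)
    [hN : IsCyclotomicExtension {2 ^ (k + 2)} ℚ N] (κ' : ZpExtension N 2) (hκ' : κ'.IsCyclotomic) : ClassicalMuVanishes κ' := by
  haveI : IsGalois ℚ N := IsCyclotomicExtension.isGalois {2 ^ (k + 2)} ℚ N
  refine classicalMuVanishes_of_isGalois_rat_of_finrank_eq_two_pow' N (k + 1) ?_ κ' hκ'
  rw [IsCyclotomicExtension.Rat.finrank (2 ^ (k + 2)) N, show k + 2 = (k + 1) + 1 by ring, Nat.totient_prime_pow_succ Nat.prime_two]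
  norm_num

/-- ★★ **`μ₂ = 0` for every `ℤ₂`-extension of `ℚ(ζ_{2^{k+2}})`, cyclotomic or not — indeed `e_n = 0` for all `n`** (Weber: `h(ℚ(ζ_{2^{k+2}}))`
is odd; one prime above `2`; Iwasawa 1956 / Greenberg Prop. 2.1; both tree theorems).  Stated next to the previous theorem for comparison: on the
cyclotomic towers §3 reproves the growth form without Weber. [cite: Washington1997, Cor. 10.5 and Prop. 13.22]
[cite: Greenberg2001IwasawaPastPresent, Prop. 2.1 p. 339 and p. 342] -/
theorem classNumberPExp_eq_zero_of_isCyclotomicExtension_two_pow (N : Type) [Field N] [NumberField N] (k : ℕ)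
    [hN : IsCyclotomicExtension {2 ^ (k + 2)} ℚ N] (κ' : ZpExtension N 2) (n : ℕ) :
    classNumberPExp κ' n = 0 := by
  haveI : IsCyclotomicExtension {2 ^ ((k + 1) + 1)} ℚ N := by rw [show (k + 1) + 1 = k + 2 by ring]; exact hN
  exact classNumberPExp_eq_zero_of_isCyclotomicExtension_prime_pow 2 (k + 1) N
    (Nat.two_dvd_ne_zero.mpr (Nat.odd_iff.mp (odd_classNumber_of_isCyclotomicExtension_two_pow N k))) κ' n

/-- ★★ **`μ₂ = 0` for the layers `ℚ_n` of the cyclotomic `ℤ₂`-extension of `ℚ` themselves** (`ℚ_n = ℚ(ζ_{2^{n+2}})⁺ ∋ √2` for `n ≥ 1`, totally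
real, Galois of degree `2^n`) and every cyclotomic `ℤ₂`-extension of `ℚ_n` (its tower is `ℚ_∞` again, shifted by `n`).
[cite: Iwasawa1973MuInvariants, §4] [cite: Washington1997, §13.1 and Prop. 13.22] -/
theorem classicalMuVanishes_layer_rat_two (κ : ZpExtension ℚ 2) (n : ℕ)
    (κ' : ZpExtension ↥(κ.layer n) 2) (hκ' : κ'.IsCyclotomic) :
    (haveI : FiniteDimensional ℚ ↥(κ.layer n) := κ.finiteDimensional_layer_holds n
     haveI : NumberField ↥(κ.layer n) := NumberField.of_module_finite ℚ _
     ClassicalMuVanishes κ') := by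
  haveI : FiniteDimensional ℚ ↥(κ.layer n) := κ.finiteDimensional_layer_holds n
  haveI : NumberField ↥(κ.layer n) := NumberField.of_module_finite ℚ _
  haveI : IsGalois ℚ ↥(κ.layer n) := κ.isGalois_layer_holds n
  exact classicalMuVanishes_of_isGalois_rat_of_finrank_eq_two_pow' ↥(κ.layer n) n (κ.finrank_layer_holds n) κ' hκ'

/-- ★★ **`μ₂ = 0` for every finite Galois `2`-power extension `K'` of an IMAGINARY QUADRATIC field `F` and every cyclotomic `ℤ₂`-extension of
`K'`, NO «`√2 ∉ K'`»** — e.g. the `2`-Hilbert class field and the whole `2`-class field tower of ANY `ℚ(√−d)` (`d = 1, 2` included), its ring /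
ray class fields of `2`-power degree, `ℚ(√−d, √a₁, …, √a_r)`; NOT assumed Galois over `ℚ`.  Base `μ₂(F) = 0` (genus theory, tree) + §2.
[cite: Iwasawa1973MuInvariants, Thm. 3 and §4] [cite: Washington1997, §13.3 Prop. 13.23] -/
theorem classicalMu_of_isGalois_of_finrank_eq_two_pow_over_imaginaryQuadratic' (F K' : Type) [Field F] [NumberField F]
    [Field K'] [NumberField K'] [Algebra F K'] [IsGalois F K'] [IsTotallyComplex F] (hF : Module.finrank ℚ F = 2)
    (m : ℕ) (hdeg : Module.finrank F K' = 2 ^ m)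
    (κ' : ZpExtension K' 2) (hκ' : κ'.IsCyclotomic) : ClassicalMuVanishes κ' :=
  classicalMu_of_isGalois_of_finrank_eq_two_pow_of_isTotallyComplex' m F K' hdeg
    (fun κP hκP ↦ classicalMuVanishes_of_finrank_eq_two F hF κP hκP) κ' hκ'

end Literature.NumberTheory.IwasawaTheory

end
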